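import Literature.NumberTheory.Sieve.FordMaynardFragmentationTzeroPrep

/-!
# Route `FordMaynardNoSieveConst0164`, crux `NegWitness0164` (stmt-Parity-19102), line `birth`,
# stub `stub_tweakNeg0164`: the Linnik weight of a three-piece fragmentation

Third helper file toward the certificate stub (K. Ford, J. Maynard, *On the theory of prime producing
sieves*, arXiv:2407.14368, §8, proof of Theorem 2.7 (c): "if `k = 3` then
`𝓛_{1/2}(u) = 2 - #{(i,j) : i < j, uᵢ + uⱼ < 1/2}`", and "if `x ∈ 𝓗₃` with all components `< 1/2` then
`𝓛_{1/2}(x) = 2`").  For a block `u = (u₀, u₁, u₂)` with all pieces `< c` and `u₀ + u₁ + u₂ ≥ c`: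
`N(univ) = 0`, `(N⋆N)(univ) = 2P`, `(N⋆N⋆N)(univ) = 6` with `P` the number of pairs of sum `< c`, so
`𝓛_c(u) = 0 - 2P/2 + 6/3 = 2 - P`.  These are the coefficients of the "α ↦ three pieces" terms and of
the dimension-3 part `I₃ = -2∫…` of `f(1)` in the certificate (`CERT-FORMAT.md` §1: `Lam(c₁c₂c₃;t) =
2 D3 - P3 - P3 - P3`, `L₃ = 2 at |x| = 1`).  Def-free.

* `sconv_univ_fin_three`, `sconv_pair`, `sconv_singleton` — expansions of the disjoint-union convolution
  (`sconv_empty` is the tree's, `FordMaynardFragmentationTzeroPrep`);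
* `linnikFn_three_eq` — `𝓛_c(u) = 2 - P`;  `linnikFn_three_eq_two` — `= 2` when every pair sums to `≥ c`
  (e.g. on the simplex `|u| = 1` with all `uᵢ < 1/2 = c`).

References: [FordMaynard2024PrimeSieves] arXiv:2407.14368, (Linnik-fcn) §5.1, §8.
-/

noncomputable section

open Finset
open Literature.Combinatorics.Enumerative
open Literature.NumberTheory.Sieve Literature.NumberTheory.Sieve.FordMaynard

namespace Summit.Parity.GeneralizedHardyLittlewood.FordMaynardNoSieveConst0164NegWitness0164

variable {α : Type*} [DecidableEq α]

/-- Sums over the subsets of a singleton. [folklore] -/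
theorem sum_powerset_singleton' (φ : Finset α → ℝ) (a : α) :
    ∑ T ∈ ({a} : Finset α).powerset, φ T = φ ∅ + φ {a} := by
  have hp : ({a} : Finset α).powerset = {∅, {a}} := by
    ext T
    rw [Finset.mem_powerset, Finset.subset_singleton_iff, Finset.mem_insert, Finset.mem_singleton]
  rw [hp, Finset.sum_pair (Finset.singleton_ne_empty a).symm]

/-- Sums over the four subsets of a pair. [folklore] -/
theorem sum_powerset_pair' {a b : α} (hab : a ≠ b) (φ : Finset α → ℝ) :
    ∑ T ∈ ({a, b} : Finset α).powerset, φ T = φ ∅ + φ {a} + φ {b} + φ {a, b} := by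
  rw [Finset.sum_powerset_insert (by rwa [Finset.mem_singleton]), sum_powerset_singleton',
    sum_powerset_singleton', show insert a (∅ : Finset α) = {a} from rfl]
  ring

/-- `(F ⋆ G)({a}) = F ∅ G {a} + F {a} G ∅`. [folklore] -/
theorem sconv_singleton (F G : Finset α → ℝ) (a : α) :
    sconv F G {a} = F ∅ * G {a} + F {a} * G ∅ := by
  unfold sconv
  rw [sum_powerset_singleton', Finset.sdiff_empty, Finset.sdiff_self]

/-- `(F ⋆ G)` at a pair `{a, b}` (`a ≠ b`): `F ∅ G {a,b} + F {a} G {b} + F {b} G {a} + F {a,b} G ∅`. [folklore] -/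
theorem sconv_pair (F G : Finset α → ℝ) {a b : α} (hab : a ≠ b) :
    sconv F G {a, b} = F ∅ * G {a, b} + F {a} * G {b} + F {b} * G {a} + F {a, b} * G ∅ := by
  unfold sconv
  rw [sum_powerset_pair' hab]
  have e2 : ({a, b} : Finset α) \ {a} = {b} := by
    ext x; simp only [Finset.mem_sdiff, Finset.mem_insert, Finset.mem_singleton]
    constructor
    · rintro ⟨h | h, h'⟩
      · exact absurd h h'
      · exact h
    · intro h; exact ⟨Or.inr h, by rw [h]; exact Ne.symm hab⟩
  have e3 : ({a, b} : Finset α) \ {b} = {a} := by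
    ext x; simp only [Finset.mem_sdiff, Finset.mem_insert, Finset.mem_singleton]
    constructor
    · rintro ⟨h | h, h'⟩
      · exact h
      · exact absurd h h'
    · intro h; exact ⟨Or.inl h, by rw [h]; exact hab⟩
  rw [Finset.sdiff_empty, e2, e3, Finset.sdiff_self]

/-- The power set of `univ : Finset (Fin 3)`. [folklore] -/
theorem powerset_univ_fin_three : (Finset.univ : Finset (Fin 3)).powerset =
    {∅, {0}, {1}, {2}, {0, 1}, {0, 2}, {1, 2}, Finset.univ} := by
  decide

/-- Disjoint-union convolution on `Fin 3` at `univ`, expanded over the eight subsets. [folklore] -/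
theorem sconv_univ_fin_three (F G : Finset (Fin 3) → ℝ) :
    sconv F G Finset.univ =
      F ∅ * G Finset.univ + F {0} * G {1, 2} + F {1} * G {0, 2} + F {2} * G {0, 1} +
        F {0, 1} * G {2} + F {0, 2} * G {1} + F {1, 2} * G {0} + F Finset.univ * G ∅ := by
  unfold sconv
  rw [powerset_univ_fin_three]
  have h1 : (∅ : Finset (Fin 3)) ∉
      ({{0}, {1}, {2}, {0, 1}, {0, 2}, {1, 2}, Finset.univ} : Finset (Finset (Fin 3))) := by decide
  have h2 : ({0} : Finset (Fin 3)) ∉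
      ({{1}, {2}, {0, 1}, {0, 2}, {1, 2}, Finset.univ} : Finset (Finset (Fin 3))) := by decide
  have h3 : ({1} : Finset (Fin 3)) ∉
      ({{2}, {0, 1}, {0, 2}, {1, 2}, Finset.univ} : Finset (Finset (Fin 3))) := by decide
  have h4 : ({2} : Finset (Fin 3)) ∉ ({{0, 1}, {0, 2}, {1, 2}, Finset.univ} : Finset (Finset (Fin 3))) := by
    decide
  have h5 : ({0, 1} : Finset (Fin 3)) ∉ ({{0, 2}, {1, 2}, Finset.univ} : Finset (Finset (Fin 3))) := by
    decide
  have h6 : ({0, 2} : Finset (Fin 3)) ∉ ({{1, 2}, Finset.univ} : Finset (Finset (Fin 3))) := by decide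
  have h7 : ({1, 2} : Finset (Fin 3)) ∉ ({Finset.univ} : Finset (Finset (Fin 3))) := by decide
  rw [Finset.sum_insert h1, Finset.sum_insert h2, Finset.sum_insert h3, Finset.sum_insert h4,
    Finset.sum_insert h5, Finset.sum_insert h6, Finset.sum_insert h7, Finset.sum_singleton]
  have e1 : (Finset.univ : Finset (Fin 3)) \ ∅ = Finset.univ := by decide
  have e2 : (Finset.univ : Finset (Fin 3)) \ {0} = {1, 2} := by decide
  have e3 : (Finset.univ : Finset (Fin 3)) \ {1} = {0, 2} := by decide
  have e4 : (Finset.univ : Finset (Fin 3)) \ {2} = {0, 1} := by decide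
  have e5 : (Finset.univ : Finset (Fin 3)) \ {0, 1} = {2} := by decide
  have e6 : (Finset.univ : Finset (Fin 3)) \ {0, 2} = {1} := by decide
  have e7 : (Finset.univ : Finset (Fin 3)) \ {1, 2} = {0} := by decide
  have e8 : (Finset.univ : Finset (Fin 3)) \ Finset.univ = ∅ := by decide
  rw [e1, e2, e3, e4, e5, e6, e7, e8]
  ring

/-- **`𝓛_c(u₀, u₁, u₂) = 2 - P`** for a three-piece block with all pieces `< c` and total `≥ c`, where
`P = #{pairs with sum < c}`: `N(univ) = 0`, `N⋆N(univ) = 2P`, `N⋆N⋆N(univ) = 6`.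
[cite: FordMaynard2024PrimeSieves, §8 (proof of Theorem 2.7 (c), "if k = 3 then 𝓛_{1/2}(u) = 2 − #{…}")] -/
theorem linnikFn_three_eq {c : ℝ} (u : Fin 3 → ℝ) (hlt : ∀ i, u i < c) (hs : c ≤ u 0 + u 1 + u 2) :
    linnikFn c u Finset.univ = 2 - ((if u 0 + u 1 < c then 1 else 0) + (if u 0 + u 2 < c then 1 else 0) +
      (if u 1 + u 2 < c then 1 else 0)) := by
  set N := smallFn c u with hN
  have hNe : N ∅ = 0 := smallFn_empty c u
  have hNs : ∀ i : Fin 3, N {i} = 1 := fun i =>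
    smallFn_eq_one (Finset.singleton_nonempty i) (by simpa using hlt i)
  have hNu : N Finset.univ = 0 := smallFn_eq_zero (by simpa [Fin.sum_univ_three, add_assoc] using hs)
  have hNp : ∀ i j : Fin 3, i ≠ j → N {i, j} = if u i + u j < c then 1 else 0 := by
    intro i j hij
    by_cases h : u i + u j < c
    · rw [if_pos h]
      exact smallFn_eq_one (Finset.insert_nonempty i {j}) (by rwa [Finset.sum_pair hij])
    · rw [if_neg h]
      exact smallFn_eq_zero (by rw [Finset.sum_pair hij]; exact not_lt.1 h)
  -- the three convolution powers at `univ`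
  have h01 : (0 : Fin 3) ≠ 1 := by decide
  have h02 : (0 : Fin 3) ≠ 2 := by decide
  have h12 : (1 : Fin 3) ≠ 2 := by decide
  have hp2_single : ∀ i : Fin 3, spow N 2 {i} = 0 := fun i => by
    rw [spow_succ, spow_succ, spow_zero, sconv_sdelta, sconv_singleton, hNe]; ring
  have hp2_pair : ∀ i j : Fin 3, i ≠ j → spow N 2 {i, j} = 2 := fun i j hij => by
    rw [spow_succ, spow_succ, spow_zero, sconv_sdelta, sconv_pair N N hij, hNe, hNs, hNs]; ring
  have hp2_empty : spow N 2 ∅ = 0 := by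
    rw [spow_succ, spow_succ, spow_zero, sconv_sdelta, sconv_empty, hNe]; ring
  have hp1 : spow N 1 Finset.univ = 0 := by
    rw [spow_succ, spow_zero, sconv_sdelta, hNu]
  have hp2 : spow N 2 Finset.univ = 2 * ((if u 0 + u 1 < c then 1 else 0) +
      (if u 0 + u 2 < c then 1 else 0) + (if u 1 + u 2 < c then 1 else 0)) := by
    rw [spow_succ, spow_succ, spow_zero, sconv_sdelta, sconv_univ_fin_three, hNe, hNu, hNs, hNs, hNs,
      hNp 0 1 h01, hNp 0 2 h02, hNp 1 2 h12]
    ring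
  have hp3 : spow N 3 Finset.univ = 6 := by
    rw [spow_succ, sconv_univ_fin_three, hNe, hNu, hNs, hNs, hNs, hp2_single, hp2_single, hp2_single,
      hp2_pair 1 2 h12, hp2_pair 0 2 h02, hp2_pair 0 1 h01, hp2_empty]
    ring
  unfold linnikFn
  rw [Fintype.card_fin, show Finset.Icc 1 3 = {1, 2, 3} from by decide,
    Finset.sum_insert (by decide), Finset.sum_pair (by norm_num), ← hN, hp1, hp2, hp3]
  simp only [wLinnik]
  norm_num
  ring

/-- **`𝓛_c(u) = 2`** for a three-piece block with all pieces `< c` and every pair summing to `≥ c` — in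
particular on the simplex `|u| = 1` with all `uᵢ < 1/2 = c` (each pair sums to `1 - uₖ > 1/2`), the
coefficient `L₃ = 2` of the dimension-3 part `I₃` of `f(1)`.
[cite: FordMaynard2024PrimeSieves, §8 ("if x ∈ 𝓗₃ with all components < 1/2 then 𝓛_{1/2}(x) = 2")] -/
theorem linnikFn_three_eq_two {c : ℝ} (u : Fin 3 → ℝ) (hlt : ∀ i, u i < c)
    (h01 : c ≤ u 0 + u 1) (h02 : c ≤ u 0 + u 2) (h12 : c ≤ u 1 + u 2) :
    linnikFn c u Finset.univ = 2 := by
  rw [linnikFn_three_eq u hlt (by linarith [hlt 2]), if_neg (not_lt.2 h01), if_neg (not_lt.2 h02),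
    if_neg (not_lt.2 h12)]
  norm_num

/-- **The weight of a three-piece fragmentation on the simplex side**: for `u₀,u₁,u₂ < 1 - γ` with every
pair summing to `≥ 1 - γ`, `blockWeight γ 3 u = 2/(3! u₀u₁u₂) = 1/(3 u₀u₁u₂)`.
[cite: FordMaynard2024PrimeSieves, §6.1 (6.3) and §8] -/
theorem blockWeight_three_eq {γ : ℝ} (u : Fin 3 → ℝ) (hlt : ∀ i, u i < 1 - γ)
    (h01 : 1 - γ ≤ u 0 + u 1) (h02 : 1 - γ ≤ u 0 + u 2) (h12 : 1 - γ ≤ u 1 + u 2) :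
    blockWeight γ 3 u = 1 / (3 * (u 0 * u 1 * u 2)) := by
  unfold blockWeight
  rw [linnikFn_three_eq_two u hlt h01 h02 h12, Fin.prod_univ_three,
    show (Nat.factorial 3 : ℝ) = 6 from by norm_num [Nat.factorial]]
  field_simp
  ring

end Summit.Parity.GeneralizedHardyLittlewood.FordMaynardNoSieveConst0164NegWitness0164

end
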